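import Literature.MathematicalPhysics.QuantumLattice.PinningFieldPairingOrder
import Literature.MathematicalPhysics.QuantumLattice.DWaveOrderParameterProofs
import HarnessLib

/-!
# The `d`-wave pair source on the `t–t'` Hubbard torus: `U(1)`, a priori bounds, the energy sandwich and
# the Koma–Tasaki levers for `dWaveOrderParameterTT'`

Topic `MathematicalPhysics/QuantumLattice` (family `hubbard`). The `t'`-generic twins of `DWaveSourceProofs.lean`
and `DWaveOrderParameterProofs.lean` (which are the case `t' = 0`) for the objects of
`DWaveSourceNNNHopping.lean` (`dWaveSourceTorusTT' L t' U μ h = H_L(1,t',U) − μN − h(Δ_d + Δ_d†)`, Xu et al.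
2024 eq. (1) with the Koma–Tasaki 1994 §1 source) and `PinningFieldPairingOrder.lean`
(`dWaveSourceDensityTT' L t' U μ h = Re ω₀(Δ_d)/L²`, `dWaveOrderParameterTT' t' U μ = liminf_{h↓0} liminf_L …`,
`HasDWaveOrderTT'`); written for cell `hubbard-cq` (the CUPRATE QUESTION at `(U, δ, t') = (8, 1/8, −1/4)`, LADDER
row PC-a; seat hubbard-cq-obsth-3). All statements are PROVED; no definition, no named fact, no `sorry`.

* `U(1)` (Koma–Tasaki's gauge rotation, PRL 1992 eqs. (5)–(8)): for ANY Hermitian `A` on a Fock space commuting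
  with the constant gauge transformation `e^{−N}`, the tracial ground state kills every singlet bond pair
  (`groundStateFunctional_bondPair_eq_zero_of_siteGauge_comm`); the unsourced `H_L(t,t',U) − μN` is such an `A`
  (both hopping terms conserve `N`), so `ω₀[H_L(t,t',U) − μN](Δ_g) = 0` for every form factor
  (`groundStateFunctional_hubbardTorusTT'_sub_mu_pairField`) and the `h = 0` slice of the sourced density
  vanishes at EVERY `t'` (`dWaveSourceDensityTT'_source_zero`).
* Tree-unit density API: `Re ω_h(Δ_d + Δ_d†) = 2L²·density`; `h ↦ density` is monotone, `≥ 0` for `h ≥ 0`,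
  `≤ 0` for `h ≤ 0`; `|density| ≤ 2Σ_e|d(e)/√2| = 4√2` for all `t', U, μ, h`; the source never raises the
  ground energy; the energy sandwich `(h' − h)·2L²·density(h) ≤ E(h) − E(h')` (all real `h, h'`).
* The Koma–Tasaki LEVERS (volume `liminf` first, then `h ↓ 0`): the inner stair
  `F(t',U,μ,h) = liminf_L density_{L+1}(h)` is monotone, `0 ≤ F ≤ 4√2` on `h ≥ 0`, `F(·,0) = 0`; the UPPER lever
  `dWaveOrderParameterTT' t' U μ ≤ F(t',U,μ,h)` at EVERY `h > 0` (one certified stair ceiling caps the order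
  parameter); the LOWER lever `(∀ h ∈ (0,h₀), ε ≤ F) → ε ≤ dWaveOrderParameterTT'`; hence
  `0 ≤ dWaveOrderParameterTT' t' U μ ≤ 4√2` for all `(t', U, μ)`.

Nothing here asserts order or its absence at any `(t', U, μ)`. Tree search: `lean search
'DensityTT._mono|OrderParameterTT._le|TT._sub_mu_pairField'` — nothing; `PinningFieldPairingOrder` has the
print-unit chord/monotonicity (`sub_mul_pinningFieldPairingOrder_le`, `pinningFieldPairingOrder_mono`) and the
`t' = 0` reductions, not the `h = 0` slice, the bounds or the levers.

References: T. Koma, H. Tasaki, J. Stat. Phys. 76 (1994) 745, §1 [cite: KomaTasaki1994, §1]; T. Koma, H. Tasaki,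
PRL 68 (1992) 3248, eqs. (5)–(8) [cite: KomaTasakiPRL1992, eqs. (5)–(8)]; H. Xu et al., Science 384 (2024)
eadh7691, eq. (1) and §III.B (volume limit at each `h_d`, then `h_d → 0`) [cite: XuEtAl2024, eq. (1)].
-/

noncomputable section

namespace Literature.MathematicalPhysics.QuantumLattice

open Matrix Finset Literature.Probability.LatticeModels HubbardWave0
  Literature.Barriers.HubbardSuperconductivity
open _root_.Filter
open scoped Matrix.Norms.L2Operator ComplexOrder _root_.Topology

/-! ### `U(1)`: no pair-field average without a source, at every `t'` -/

section GaugeInvariance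

variable {Λ : Type*} [LinearOrder Λ] [Fintype Λ]

/-- For a Hermitian `A` on the Fock space of `Λ` commuting with Koma–Tasaki's constant gauge transformation
`e^{−N}`, the tracial ground state kills every singlet bond pair: `ω_A(b_{uv}) = 0` (the rotation multiplies
`b_{uv}` by `e² ≠ 1` and leaves `ω_A` invariant). [cite: KomaTasakiPRL1992, eqs. (5)–(8)] -/
theorem groundStateFunctional_bondPair_eq_zero_of_siteGauge_comm
    {A : Matrix (Finset (Orb Λ)) (Finset (Orb Λ)) ℂ} (hA : A.IsHermitian)
    (hcomm : siteGauge (fun _ : Λ => (1 : ℝ)) * A = A * siteGauge (fun _ : Λ => (1 : ℝ))) (u v : Λ) :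
    A.groundStateFunctional (bondPair u v) = 0 := by
  have hinv : siteGauge (-fun _ : Λ => (1 : ℝ)) * siteGauge (fun _ : Λ => (1 : ℝ)) = 1 :=
    siteGauge_neg_mul_siteGauge _
  have h1 := groundStateFunctional_conj_of_commute_of_inverse hA hcomm hinv (bondPair u v)
  rw [siteGauge_mul_bondPair_mul, LinearMap.map_smul_of_tower, smul_eq_mul] at h1
  have hne : ((Real.exp ((1 : ℝ) + 1) : ℝ) : ℂ) - 1 ≠ 0 := by
    rw [sub_ne_zero, Ne, Complex.ofReal_eq_one, Real.exp_eq_one_iff]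
    norm_num
  have h2 : (((Real.exp ((1 : ℝ) + 1) : ℝ) : ℂ) - 1) * A.groundStateFunctional (bondPair u v) = 0 := by
    rw [sub_mul, one_mul, sub_eq_zero]
    exact h1
  exact (mul_eq_zero.1 h2).resolve_left hne

/-- The constant gauge transformation commutes with the sum of a grand-canonical and a plain graph Hubbard
Hamiltonian on one vertex set (both conserve the particle number). [cite: KomaTasakiPRL1992, eq. (7)] -/
theorem siteGauge_const_mul_hamiltonianWith_add_hamiltonian (G₁ G₂ : SimpleGraph Λ) [DecidableRel G₁.Adj]
    [DecidableRel G₂.Adj] (c t U μ t' U' : ℝ) :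
    siteGauge (fun _ : Λ => c) * (hamiltonianWith G₁ t U μ + hamiltonian G₂ t' U') =
      (hamiltonianWith G₁ t U μ + hamiltonian G₂ t' U') * siteGauge (fun _ : Λ => c) := by
  have h2 := siteGauge_const_mul_hamiltonianWith G₂ c t' U' 0
  rw [hamiltonianWith_zero] at h2
  rw [Matrix.mul_add, Matrix.add_mul, siteGauge_const_mul_hamiltonianWith, h2]

/-- Hence its tracial ground state kills every singlet bond pair. [cite: KomaTasakiPRL1992, eqs. (5)–(8)] -/
theorem groundStateFunctional_hamiltonianWith_add_hamiltonian_bondPair (G₁ G₂ : SimpleGraph Λ)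
    [DecidableRel G₁.Adj] [DecidableRel G₂.Adj] (t U μ t' U' : ℝ) (u v : Λ) :
    (hamiltonianWith G₁ t U μ + hamiltonian G₂ t' U').groundStateFunctional (bondPair u v) = 0 :=
  groundStateFunctional_bondPair_eq_zero_of_siteGauge_comm
    ((isHermitian_hamiltonianWith G₁ t U μ).add (hamiltonian_isHermitian_and_commute_holds G₂ t' U').1)
    (siteGauge_const_mul_hamiltonianWith_add_hamiltonian G₁ G₂ 1 t U μ t' U') u v

variable (g : Site 2 → ℝ) (L : ℕ) [NeZero L]

omit [NeZero L] in
/-- The unsourced part splits into a grand-canonical and a plain graph Hamiltonian: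
`H_L(t,t',U) − μN = (H_{n.n.}(t,U) − μN) + H_{diag}(t',0)`. [cite: XuEtAl2024, eq. (1)] -/
theorem hubbardTorusTT'_sub_mu_eq (t t' U μ : ℝ) :
    hubbardTorusTT' L t t' U - (μ : ℂ) • totalNumber =
      hamiltonianWith (fermionTorusGraph 2 L) t U μ + hamiltonian (fermionTorusDiagGraph L) t' 0 := by
  rw [hubbardTorusTT', hamiltonianWith_eq]
  abel

/-- **No pair-field average without a source at any `t'`**: `ω₀[H_L(t,t',U) − μN](Δ_g) = 0` for every form
factor `g` and all `t, t', U, μ`. [cite: KomaTasaki1994, §1] -/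
theorem groundStateFunctional_hubbardTorusTT'_sub_mu_pairField (t t' U μ : ℝ) :
    (hubbardTorusTT' L t t' U - (μ : ℂ) • totalNumber).groundStateFunctional (pairField g L) = 0 := by
  rw [hubbardTorusTT'_sub_mu_eq, pairField, map_sum]
  refine Finset.sum_eq_zero fun x _ => ?_
  rw [localPair_eq_sum_bondPair, map_sum]
  refine Finset.sum_eq_zero fun e _ => ?_
  rw [LinearMap.map_smul_of_tower, smul_eq_zero]
  right
  -- `convert` closes the `DecidableEq`-instance mismatch on `Finset (Orb (FermionTorus 2 L))` by subsingleton
  have h0 := groundStateFunctional_hamiltonianWith_add_hamiltonian_bondPair (fermionTorusGraph 2 L)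
    (fermionTorusDiagGraph L) t U μ t' 0 (FermionTorus.ofTorusSite x) (FermionTorus.ofTorusSite (x + Torus.proj L e))
  convert h0 using 4

/-- **The `h = 0` slice of the sourced density vanishes identically at every `t'`** (so the source `h > 0` and
the order of limits are what make `dWaveOrderParameterTT'` non-trivial). [cite: KomaTasaki1994, §1] -/
theorem dWaveSourceDensityTT'_source_zero (t' U μ : ℝ) : dWaveSourceDensityTT' L t' U μ 0 = 0 := by
  rw [dWaveSourceDensityTT', dWaveSourceTorusTT'_zero_source,
    groundStateFunctional_hubbardTorusTT'_sub_mu_pairField]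
  simp

end GaugeInvariance

/-! ### A priori bound, `Re ω(Δ + Δ†) = 2L²·density`, monotonicity, sign, energy sandwich -/

section Sandwich

variable (L : ℕ) [NeZero L]

/-- **A priori bound**, for ALL `t', U, μ, h`: `|dWaveSourceDensityTT' L t' U μ h| ≤ 2Σ_e |d(e)/√2| (= 4√2)` —
so the real `liminf`s defining `dWaveOrderParameterTT'` are never junk. [cite: KomaTasaki1994, §1] -/
theorem abs_dWaveSourceDensityTT'_le (t' U μ h : ℝ) :
    |dWaveSourceDensityTT' L t' U μ h| ≤ 2 * ∑ e ∈ insert (0 : Site 2) unitSteps, |dWaveFormFactor e / Real.sqrt 2| := by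
  have hL := cast_sq_pos_of_neZero L
  rw [dWaveSourceDensityTT', abs_div, abs_of_pos hL, div_le_iff₀ hL]
  exact (abs_re_groundStateFunctional_le_norm (dWaveSourceTorusTT'_isHermitian L t' U μ h) _).trans
    (norm_pairField_le dWaveFormFactor L)

/-- Pointwise upper bound `dWaveSourceDensityTT' ≤ 4√2`. [cite: KomaTasaki1994, §1] -/
theorem dWaveSourceDensityTT'_le_const (t' U μ h : ℝ) :
    dWaveSourceDensityTT' L t' U μ h ≤ 2 * ∑ e ∈ insert (0 : Site 2) unitSteps, |dWaveFormFactor e / Real.sqrt 2| :=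
  (le_abs_self _).trans (abs_dWaveSourceDensityTT'_le L t' U μ h)

/-- `Re ω_h(Δ_d + Δ_d†) = 2L² · dWaveSourceDensityTT'` (the tree's density is HALF of Koma–Tasaki's
`ω(O_Λ)/|Λ|` for `O = Δ_d + Δ_d†`). [cite: KomaTasaki1994, §1] -/
theorem re_groundStateFunctional_dWaveSourceTT'_op (t' U μ h : ℝ) :
    ((dWaveSourceTorusTT' L t' U μ h).groundStateFunctional
        (pairField dWaveFormFactor L + (pairField dWaveFormFactor L)ᴴ)).re =
      2 * (L : ℝ) ^ 2 * dWaveSourceDensityTT' L t' U μ h := by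
  have hL : (L : ℝ) ≠ 0 := by exact_mod_cast NeZero.ne L
  rw [map_add, Complex.add_re, groundStateFunctional_conjTranspose_re, dWaveSourceDensityTT']
  field_simp
  ring

variable {L}

/-- **Monotonicity in the source**: `h ↦ dWaveSourceDensityTT' L t' U μ h` is non-decreasing on `ℝ`
(concavity of the sourced ground-state energy). [cite: KomaTasaki1994, §1] -/
theorem dWaveSourceDensityTT'_mono (t' U μ : ℝ) {h h' : ℝ} (hle : h ≤ h') :
    dWaveSourceDensityTT' L t' U μ h ≤ dWaveSourceDensityTT' L t' U μ h' := by
  have key := re_groundStateFunctional_source_mono (isHermitian_hubbardTorusTT'_sub_smul_totalNumber L t' U μ)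
    (isHermitian_pairField_add_conjTranspose L) hle
  rw [← dWaveSourceTorusTT'_eq, ← dWaveSourceTorusTT'_eq,
    re_groundStateFunctional_dWaveSourceTT'_op, re_groundStateFunctional_dWaveSourceTT'_op] at key
  have hL : (0 : ℝ) < 2 * (L : ℝ) ^ 2 := by
    have := cast_sq_pos_of_neZero L
    positivity
  exact le_of_mul_le_mul_left key hL

/-- `0 ≤ dWaveSourceDensityTT' L t' U μ h` for `h ≥ 0` (no sign consideration refutes a positive floor).
[cite: KomaTasaki1994, §1] -/
theorem dWaveSourceDensityTT'_nonneg (t' U μ : ℝ) {h : ℝ} (hh : 0 ≤ h) : 0 ≤ dWaveSourceDensityTT' L t' U μ h := by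
  rw [← dWaveSourceDensityTT'_source_zero L t' U μ]
  exact dWaveSourceDensityTT'_mono t' U μ hh

/-- `dWaveSourceDensityTT' L t' U μ h ≤ 0` for `h ≤ 0`. [cite: KomaTasaki1994, §1] -/
theorem dWaveSourceDensityTT'_nonpos (t' U μ : ℝ) {h : ℝ} (hh : h ≤ 0) : dWaveSourceDensityTT' L t' U μ h ≤ 0 := by
  rw [← dWaveSourceDensityTT'_source_zero L t' U μ]
  exact dWaveSourceDensityTT'_mono t' U μ hh

/-- The source never raises the ground-state energy: `E₀(H_{L,h}(t')) ≤ E₀(H_{L,0}(t'))` for every real `h`.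
[cite: KomaTasaki1994, §1] -/
theorem groundEnergy_dWaveSourceTorusTT'_le (t' U μ h : ℝ) :
    (dWaveSourceTorusTT' L t' U μ h).groundEnergy ≤ (dWaveSourceTorusTT' L t' U μ 0).groundEnergy := by
  have h0 : ((hubbardTorusTT' L 1 t' U - (μ : ℂ) • totalNumber).groundStateFunctional
      (pairField dWaveFormFactor L + (pairField dWaveFormFactor L)ᴴ)).re = 0 := by
    rw [map_add, Complex.add_re, groundStateFunctional_conjTranspose_re,
      groundStateFunctional_hubbardTorusTT'_sub_mu_pairField]
    simp
  have := groundEnergy_source_le_of_re_eq_zero (isHermitian_hubbardTorusTT'_sub_smul_totalNumber L t' U μ)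
    (isHermitian_pairField_add_conjTranspose L) h0 h
  rw [← dWaveSourceTorusTT'_eq] at this
  rwa [dWaveSourceTorusTT'_zero_source]

/-- **Energy sandwich** (all real `h, h'`):
`(h' − h) · 2L² · dWaveSourceDensityTT' L t' U μ h ≤ E₀(H_{L,h}(t')) − E₀(H_{L,h'}(t'))`. [cite: KomaTasaki1994, §1] -/
theorem dWaveSourceDensityTT'_mul_le_groundEnergy_drop (t' U μ h h' : ℝ) :
    (h' - h) * (2 * (L : ℝ) ^ 2 * dWaveSourceDensityTT' L t' U μ h) ≤
      (dWaveSourceTorusTT' L t' U μ h).groundEnergy - (dWaveSourceTorusTT' L t' U μ h').groundEnergy := by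
  have := sub_mul_re_groundStateFunctional_le (isHermitian_hubbardTorusTT'_sub_smul_totalNumber L t' U μ)
    (isHermitian_pairField_add_conjTranspose L) h h'
  rwa [← dWaveSourceTorusTT'_eq, ← dWaveSourceTorusTT'_eq, re_groundStateFunctional_dWaveSourceTT'_op] at this

/-- Lower half of the sandwich against the source-free energy: `E₀(H_{L,0}) − E₀(H_{L,h}) ≤ 2hL²·density(h)`.
[cite: KomaTasaki1994, §1] -/
theorem groundEnergy_gain_le_dWaveSourceDensityTT' (t' U μ h : ℝ) :
    (dWaveSourceTorusTT' L t' U μ 0).groundEnergy - (dWaveSourceTorusTT' L t' U μ h).groundEnergy ≤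
      2 * h * (L : ℝ) ^ 2 * dWaveSourceDensityTT' L t' U μ h := by
  have := dWaveSourceDensityTT'_mul_le_groundEnergy_drop (L := L) t' U μ h 0
  nlinarith [this]

end Sandwich

/-! ### The Koma–Tasaki levers: the inner stair and both sides of `dWaveOrderParameterTT'` -/

section Levers

/-- The inner stair `F(t',U,μ,h) = liminf_L density_{L+1}(h)` is non-decreasing in `h ≥ 0`. [cite: KomaTasaki1994, §1] -/
theorem liminf_dWaveSourceDensityTT'_mono (t' U μ : ℝ) {h h' : ℝ} (hh : 0 ≤ h) (hle : h ≤ h') :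
    liminf (fun L : ℕ => dWaveSourceDensityTT' (L + 1) t' U μ h) atTop ≤
      liminf (fun L : ℕ => dWaveSourceDensityTT' (L + 1) t' U μ h') atTop := by
  refine liminf_le_liminf (Eventually.of_forall fun _ => dWaveSourceDensityTT'_mono t' U μ hle) ?_ ?_
  · exact isBoundedUnder_of_eventually_ge (a := 0)
      (Eventually.of_forall fun _ => dWaveSourceDensityTT'_nonneg t' U μ hh)
  · exact isCoboundedUnder_ge_of_eventually_le atTop
      (x := 2 * ∑ e ∈ insert (0 : Site 2) unitSteps, |dWaveFormFactor e / Real.sqrt 2|)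
      (Eventually.of_forall fun _ => dWaveSourceDensityTT'_le_const _ t' U μ h')

/-- `0 ≤ F(t',U,μ,h)` for `h ≥ 0`. [cite: KomaTasaki1994, §1] -/
theorem liminf_dWaveSourceDensityTT'_nonneg (t' U μ : ℝ) {h : ℝ} (hh : 0 ≤ h) :
    0 ≤ liminf (fun L : ℕ => dWaveSourceDensityTT' (L + 1) t' U μ h) atTop :=
  le_liminf_of_le
    (isCoboundedUnder_ge_of_eventually_le atTop
      (x := 2 * ∑ e ∈ insert (0 : Site 2) unitSteps, |dWaveFormFactor e / Real.sqrt 2|)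
      (Eventually.of_forall fun _ => dWaveSourceDensityTT'_le_const _ t' U μ h))
    (Eventually.of_forall fun _ => dWaveSourceDensityTT'_nonneg t' U μ hh)

/-- `F(t',U,μ,h) ≤ 4√2` for `h ≥ 0`. [cite: KomaTasaki1994, §1] -/
theorem liminf_dWaveSourceDensityTT'_le_const (t' U μ : ℝ) {h : ℝ} (hh : 0 ≤ h) :
    liminf (fun L : ℕ => dWaveSourceDensityTT' (L + 1) t' U μ h) atTop ≤
      2 * ∑ e ∈ insert (0 : Site 2) unitSteps, |dWaveFormFactor e / Real.sqrt 2| :=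
  liminf_le_of_frequently_le
    (Frequently.of_forall fun _ => dWaveSourceDensityTT'_le_const _ t' U μ h)
    (isBoundedUnder_of_eventually_ge (a := 0)
      (Eventually.of_forall fun _ => dWaveSourceDensityTT'_nonneg t' U μ hh))

/-- The source-free stair is `0`. [cite: KomaTasaki1994, §1] -/
theorem liminf_dWaveSourceDensityTT'_source_zero (t' U μ : ℝ) :
    liminf (fun L : ℕ => dWaveSourceDensityTT' (L + 1) t' U μ 0) atTop = 0 := by
  have : (fun L : ℕ => dWaveSourceDensityTT' (L + 1) t' U μ 0) = fun _ => 0 :=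
    funext fun _ => dWaveSourceDensityTT'_source_zero _ _ _ _
  rw [this, liminf_const]

/-- **Upper lever**: `dWaveOrderParameterTT' t' U μ ≤ F(t',U,μ,h)` for EVERY `h > 0` — one certified ceiling on
the stair at one positive source strength, uniform in large `L`, caps the order parameter. [cite: KomaTasaki1994, §1] -/
theorem dWaveOrderParameterTT'_le_liminf (t' U μ : ℝ) {h : ℝ} (hh : 0 < h) :
    dWaveOrderParameterTT' t' U μ ≤ liminf (fun L : ℕ => dWaveSourceDensityTT' (L + 1) t' U μ h) atTop := by
  rw [dWaveOrderParameterTT']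
  have hev : ∀ᶠ h' in 𝓝[>] (0 : ℝ), liminf (fun L : ℕ => dWaveSourceDensityTT' (L + 1) t' U μ h') atTop ≤
      liminf (fun L : ℕ => dWaveSourceDensityTT' (L + 1) t' U μ h) atTop := by
    filter_upwards [Ioo_mem_nhdsGT hh] with h' hh'
    exact liminf_dWaveSourceDensityTT'_mono t' U μ hh'.1.le hh'.2.le
  have hbdd : ∀ᶠ h' in 𝓝[>] (0 : ℝ),
      0 ≤ liminf (fun L : ℕ => dWaveSourceDensityTT' (L + 1) t' U μ h') atTop := by
    filter_upwards [self_mem_nhdsWithin] with h' hh'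
    exact liminf_dWaveSourceDensityTT'_nonneg t' U μ (le_of_lt hh')
  exact liminf_le_of_frequently_le hev.frequently (isBoundedUnder_of_eventually_ge hbdd)

/-- **Lower lever**: a floor on the stair for all small `h > 0` is a floor on the order parameter.
[cite: KomaTasaki1994, §1] -/
theorem le_dWaveOrderParameterTT'_of_forall (t' U μ : ℝ) {ε h₀ : ℝ} (hh₀ : 0 < h₀)
    (H : ∀ h ∈ Set.Ioo 0 h₀, ε ≤ liminf (fun L : ℕ => dWaveSourceDensityTT' (L + 1) t' U μ h) atTop) :
    ε ≤ dWaveOrderParameterTT' t' U μ := by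
  rw [dWaveOrderParameterTT']
  refine le_liminf_of_le ?_ ?_
  · refine isCoboundedUnder_ge_of_eventually_le _
      (x := 2 * ∑ e ∈ insert (0 : Site 2) unitSteps, |dWaveFormFactor e / Real.sqrt 2|) ?_
    filter_upwards [self_mem_nhdsWithin] with h' hh'
    exact liminf_dWaveSourceDensityTT'_le_const t' U μ (le_of_lt hh')
  · filter_upwards [Ioo_mem_nhdsGT hh₀] with h hh
    exact H h hh

/-- The order parameter is never negative, for ALL `(t', U, μ)`. [cite: KomaTasaki1994, §1] -/
theorem dWaveOrderParameterTT'_nonneg (t' U μ : ℝ) : 0 ≤ dWaveOrderParameterTT' t' U μ :=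
  le_dWaveOrderParameterTT'_of_forall t' U μ zero_lt_one fun _ hh =>
    liminf_dWaveSourceDensityTT'_nonneg t' U μ hh.1.le

/-- … and never exceeds `4√2`. [cite: KomaTasaki1994, §1] -/
theorem dWaveOrderParameterTT'_le_const (t' U μ : ℝ) :
    dWaveOrderParameterTT' t' U μ ≤ 2 * ∑ e ∈ insert (0 : Site 2) unitSteps, |dWaveFormFactor e / Real.sqrt 2| :=
  (dWaveOrderParameterTT'_le_liminf t' U μ zero_lt_one).trans
    (liminf_dWaveSourceDensityTT'_le_const t' U μ zero_le_one)

/-- **Staircase form**: `ε ≤ dWaveOrderParameterTT' t' U μ ↔ ∀ h > 0, ε ≤ F(t',U,μ,h)` — the order clause is the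
conjunction of ALL its stairs; a floor on stairs bounded away from `h = 0` proves nothing by itself.
[cite: KomaTasaki1994, §1] -/
theorem le_dWaveOrderParameterTT'_iff_forall (t' U μ ε : ℝ) :
    ε ≤ dWaveOrderParameterTT' t' U μ ↔
      ∀ h : ℝ, 0 < h → ε ≤ liminf (fun L : ℕ => dWaveSourceDensityTT' (L + 1) t' U μ h) atTop := by
  constructor
  · intro hε h hh
    exact hε.trans (dWaveOrderParameterTT'_le_liminf t' U μ hh)
  · intro H
    exact le_dWaveOrderParameterTT'_of_forall t' U μ zero_lt_one fun h hh => H h hh.1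

end Levers

end Literature.MathematicalPhysics.QuantumLattice

end
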